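import Summits.ResolutionOfSingularities.ResolutionOfSingularities.Theorems.FrobeniusClosingPatchingRelPerfectConeDepthSmoothConeLadder
import Summits.ResolutionOfSingularities.ResolutionOfSingularities.Theorems.FrobeniusClosingPatchingRelPerfectConeDepthLadderClimb
import Summits.ResolutionOfSingularities.ResolutionOfSingularities.Theorems.FrobeniusClosingPatchingRelPerfectConeDepthSmoothQuadricRung
import HarnessLib

/-!
# Crux `PatchingRelPerfect` (stmt-ResolutionOfSingularities-16161), chain W5.2 — rung «r-smooth-cone-ℓ», CLIMBING THE LADDER:
# the END in companion form, the induction on the vertex exponent, and the foot of the ladder on `Spec S`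

[OURS · L1 W5.2 · rung tool] Replaces the role of NO printed item; NOT a statement of the manuscript under review; fact-free,
any characteristic, any residue field, any degree `d ≥ 2`.  AI-written (AI review is weaker than expert review).

For the cone `q = N(x₀, x₁, x₂)` over a SMOOTH PLANE CURVE of degree `d` (`N ∈ S[U₀,U₁,U₂]` a form with the certificates (HV),
(HC) of `…SmoothConeCharts` on its reduced chart polynomials) in a regular local `S` with regular system of parameters `x₀, …, x₃`:
* `SmoothConeState.companion_of_zero` — the END at vertex exponent `b = 0` (companion form, `coneEndCompanion`);
* `SmoothConeState.companion` — THE LADDER: strong induction on `b`, each rung `SmoothConeState.step` (weight `d`, no hypothesis: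
  the smooth-cone vertex fibre theorem is a theorem);
* `SmoothConeState.initial` — THE FOOT: `X₁ = Bl_𝔪 Spec S` carries a state for `I = (q) + 𝔪^{ℓ+d}` with exponents `(0, ℓ)`:
  `I𝒪_{X₁} = 𝓘_{E₁}^d · (𝓗₁ ⊔ 𝓘_{E₁}^ℓ)`, the vertex from `smoothCone_vertex_fibre` on `Spec S` with `(x₃, x₀, x₁, x₂)` and the
  form moved to `𝒪_{Spec S, 𝔪} = S` (certificates transported along the local structure map).

## References
* J. Kollár, *Lectures on Resolution of Singularities* (2007), 3.61, (3.111) Step 3. [Kollar2007]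
* Q. Liu, *Algebraic Geometry and Arithmetic Curves*, OUP 2002, Thm. 8.1.19 (a). [Liu2002]
* R. Hartshorne, *Algebraic Geometry*, Springer 1977, II Prop. 5.1 (b). [Hartshorne1977]
* The Stacks Project, Tags 080A, 080B. [StacksProject]
-/

set_option linter.dupNamespace false

noncomputable section

open CategoryTheory CategoryTheory.Limits AlgebraicGeometry TopologicalSpace IsLocalRing
open Literature.AlgebraicGeometry.Resolution
open Scheme.IdealSheafData
open scoped Pointwise

namespace Summit.ResolutionOfSingularities.ResolutionOfSingularities.Theorems

universe u

namespace ConeDepth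

section Climb

variable {S : Type u} [CommRing S] [IsRegularLocalRing S] {deg : ℕ} {I : Ideal S}

namespace SmoothConeState

/-- **The END applies at exponent `b = 0`, companion form.** [cite: Kollar2007, (3.111) Step 3] [cite: StacksProject, Tag 080A] -/
theorem companion_of_zero {X : Scheme.{u}} {g : X ⟶ Spec (.of S)} {M 𝓗 E : X.IdealSheafData}
    {A B : List (X.IdealSheafData × ℕ)} {a : ℕ} {z : X} (h : SmoothConeState deg I X g M 𝓗 E A B a 0 z) (hI : I ≠ ⊥)
    (hIm : ((affineBlowup.idealSheaf I).support : Set (Spec (.of S))) ⊆ {IsLocalRing.closedPoint S}) :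
    ∃ (Q : Ideal S) (m : ℕ), IsLocalRing.maximalIdeal S ^ m ≤ Q ∧
      ∃ (B' : Scheme.{u}) (b : B' ⟶ Spec (.of S)),
        IsBlowup b (affineBlowup.idealSheaf (I * Q)) ∧ Scheme.IsRegular B' := by
  haveI := h.isNoetherian
  have hK : 𝓗 * monomialIdeal (A ++ [(E, a)]) ⊔ monomialIdeal (B ++ [(E, 0)]) =
      monomialIdeal ((𝓗, 1) :: (A ++ [(E, a)])) ⊔ monomialIdeal ((𝓗, 0) :: (B ++ [(E, 0)])) := by
    rw [monomialIdeal_cons, monomialIdeal_cons, pow_one, pow_zero, Scheme.IdealSheafData.one_eq_top,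
      Scheme.IdealSheafData.top_mul]
  have hfmt := h.format
  rw [hK] at hfmt
  have hover : ∀ x : X, x ∈ (monomialIdeal ((𝓗, 1) :: (A ++ [(E, a)])) ⊔ monomialIdeal ((𝓗, 0) :: (B ++ [(E, 0)]))).support →
      g x = IsLocalRing.closedPoint S := by
    intro x hx
    have hxI : x ∈ ((affineBlowup.idealSheaf I).comap g).support := by
      rw [hfmt, Scheme.IdealSheafData.support_mul]
      exact Or.inr hx
    rw [Scheme.IdealSheafData.support_comap] at hxI
    exact hIm hxI
  refine coneEndCompanion hI h.isRegular h.exists_isBlowup h.isLocallyPrincipal _ _ ?_ ?_ hover hfmt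
  · show 𝓗 :: boundaryOf (A ++ [(E, a)]) = 𝓗 :: boundaryOf (B ++ [(E, 0)])
    rw [boundaryOf_append, boundaryOf_append, h.boundaryOf_eq]
    rfl
  · intro x hx
    have hxz : x ≠ z := by
      rintro rfl
      rw [← hK] at hx
      have hB : stalkIdeal (monomialIdeal (B ++ [(E, 0)])) x = ⊤ := by
        rw [stalkIdeal_monomialIdeal, List.map_append, List.prod_append, List.map_singleton, List.prod_singleton,
          pow_zero, mul_one, ← Ideal.one_eq_top]
        refine List.prod_eq_one fun J hJ => ?_
        obtain ⟨p, hp, rfl⟩ := List.mem_map.mp hJ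
        have hD : x ∉ p.1.support := h.not_mem_support p.1 (h.boundaryOf_eq ▸ fst_mem_boundaryOf hp)
        rw [stalkIdeal_eq_top_of_not_mem_support hD, Ideal.top_pow, Ideal.one_eq_top]
      rw [mem_support_iff_stalkIdeal_ne_top, stalkIdeal_sup, hB] at hx
      exact hx (sup_top_eq _)
    have := h.snc x (hover x hx) hxz
    show DepthSNC.SNCWithAt (𝓗 :: boundaryOf (A ++ [(E, a)])) ⊤ x
    rwa [boundaryOf_append]

/-- **THE LADDER (companion form), smooth-cone version.**  Every state gives `I` an `𝔪`-primary companion with a regular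
blowing up: strong induction on the vertex exponent `b` — at `b = 0` the END; otherwise blow up the vertex (`blowup.π 𝓘_z`) with
`step` (the smooth-cone vertex fibre theorem inside), and `b - min (a+d) b < b` as `d ≥ 2`. [cite: Kollar2007, 3.61 and (3.111) Step 3]
[cite: StacksProject, Tag 080A] -/
theorem companion (hI : I ≠ ⊥) (hIm : ((affineBlowup.idealSheaf I).support : Set (Spec (.of S))) ⊆ {IsLocalRing.closedPoint S})
    (b : ℕ) :
    ∀ {X : Scheme.{u}} {g : X ⟶ Spec (.of S)} {M 𝓗 E : X.IdealSheafData} {A B : List (X.IdealSheafData × ℕ)}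
      {a : ℕ} {z : X}, SmoothConeState deg I X g M 𝓗 E A B a b z →
      ∃ (Q : Ideal S) (m : ℕ), IsLocalRing.maximalIdeal S ^ m ≤ Q ∧
        ∃ (B' : Scheme.{u}) (b : B' ⟶ Spec (.of S)),
          IsBlowup b (affineBlowup.idealSheaf (I * Q)) ∧ Scheme.IsRegular B' := by
  induction b using Nat.strong_induction_on with
  | _ b ih =>
    intro X g M 𝓗 E A B a z h
    rcases Nat.eq_zero_or_pos b with rfl | hb
    · exact h.companion_of_zero hI hIm
    · have hσ := blowup.isBlowup (vanishingIdeal (⟨{z}, h.isClosed⟩ : Closeds X))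
      obtain ⟨z', h'⟩ := h.step hσ
      have h2 := h.two_le
      have hlt : b - min (a + deg) b < b := by omega
      exact ih _ hlt h'

/-! ## §6' The foot of the ladder: the first blowing up of `Spec S` -/

/-- **THE FOOT OF THE LADDER.**  For `S` regular local with a regular system of parameters `x₀, …, x₃` (spanning `𝔪`,
`μ(𝔪) = 4`), a form `N ∈ S[U₀,U₁,U₂]` of degree `d ≥ 2` with the certificates (HV), (HC), and `I = (N(x₀,x₁,x₂)) + 𝔪^{ℓ+d}`: the
blowing up `σ₁ : X₁ = Bl_𝔪 Spec S → Spec S` carries a smooth-cone state with vertex exponents `(0, ℓ)` —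
`I𝒪_{X₁} = 𝓘_{E₁}^d · (𝓗₁ ⊔ 𝓘_{E₁}^ℓ)`, `𝓗₁ = σ₁ᶜ((q)~, d)`; the vertex and the simple normal crossings off it come from the
SMOOTH-CONE VERTEX FIBRE THEOREM applied to `Spec S` at its closed point with the regular system `(x₃, x₀, x₁, x₂)` of
`𝒪_{Spec S, 𝔪} = S` (`x₃` a dummy carrier) and the form `N` moved along `S → S_𝔪`.
[cite: Kollar2007, 3.61] [cite: Liu2002, Thm. 8.1.19 (a)] [cite: Hartshorne1977, II Prop. 5.1 (b)] -/
theorem initial (x : Fin 4 → S) (hx : Ideal.span (Set.range x) = maximalIdeal S) (hd : (maximalIdeal S).spanFinrank = 4)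
    (hdeg : 2 ≤ deg) (N : MvPolynomial (Fin 3) S) (hN : N.IsHomogeneous deg)
    (hV : ∃ m : ℕ, Ideal.span (Set.range (MvPolynomial.X : {j : Fin 4 // j ≠ (0 : Fin 4)} → _)) ^ m ≤
      Ideal.span (insert (chartPoly (MvPolynomial.rename Fin.succ N) 0)
        (Set.range fun t => MvPolynomial.pderiv t (chartPoly (MvPolynomial.rename Fin.succ N) 0))))
    (hC : ∀ i : Fin 4, i ≠ 0 → Ideal.span (insert (chartPoly (MvPolynomial.rename Fin.succ N) i)
      (Set.range fun t => MvPolynomial.pderiv t (chartPoly (MvPolynomial.rename Fin.succ N) i))) = ⊤) (ℓ : ℕ) :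
    ∃ z₁ : blowup (affineBlowup.idealSheaf (maximalIdeal S)),
      SmoothConeState deg (Ideal.span {MvPolynomial.eval (fun k : Fin 3 => x k.castSucc) N} ⊔ maximalIdeal S ^ (ℓ + deg))
        (blowup (affineBlowup.idealSheaf (maximalIdeal S))) (blowup.π (affineBlowup.idealSheaf (maximalIdeal S)))
        ((affineBlowup.idealSheaf (maximalIdeal S)).comap (blowup.π (affineBlowup.idealSheaf (maximalIdeal S))) ^ deg)
        (controlledTransform (blowup.π (affineBlowup.idealSheaf (maximalIdeal S))) (affineBlowup.idealSheaf (maximalIdeal S))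
          (affineBlowup.idealSheaf (Ideal.span {MvPolynomial.eval (fun k : Fin 3 => x k.castSucc) N})) deg)
        ((affineBlowup.idealSheaf (maximalIdeal S)).comap (blowup.π (affineBlowup.idealSheaf (maximalIdeal S))))
        [] [] 0 ℓ z₁ := by
  classical
  set q : S := MvPolynomial.eval (fun k : Fin 3 => x k.castSucc) N with hqdef
  set J₀ : (Spec (.of S)).IdealSheafData := affineBlowup.idealSheaf (maximalIdeal S) with hJ₀
  set σ := blowup.π J₀ with hσdef
  have hσ : IsBlowup σ J₀ := blowup.isBlowup J₀
  set Hq : (Spec (.of S)).IdealSheafData := affineBlowup.idealSheaf (Ideal.span {q}) with hHq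
  set G₀ : (Spec (.of S)).IdealSheafData := affineBlowup.idealSheaf (Ideal.span {x 3}) with hG₀
  haveI : IsDomain S := isDomain_of_isRegularLocalRing S
  haveI : IsRegularRing S := isRegularRing_of_isRegularLocalRing S
  haveI : IsIntegral (Spec (.of S)) := inferInstanceAs (IsIntegral (Spec (CommRingCat.of S)))
  -- the closed point and its local ring `𝒪_{Spec S, 𝔪} = S_𝔪`
  let z₀ : Spec (.of S) := IsLocalRing.closedPoint S
  have hz₀ : IsClosed ({z₀} : Set (Spec (.of S))) :=
    (PrimeSpectrum.isClosed_singleton_iff_isMaximal _).mpr (IsLocalRing.maximalIdeal.isMaximal S)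
  letI : Algebra S ((Spec (.of S)).presheaf.stalk z₀) :=
    inferInstanceAs (Algebra S ((Spec.structureSheaf S).presheaf.stalk z₀))
  haveI : IsLocalization.AtPrime ((Spec (.of S)).presheaf.stalk z₀) (maximalIdeal S) :=
    inferInstanceAs (IsLocalization.AtPrime ((Spec.structureSheaf S).presheaf.stalk z₀) z₀.asIdeal)
  haveI hregA : IsRegularLocalRing ((Spec (.of S)).presheaf.stalk z₀) := Scheme.isRegular_Spec (.of S) z₀
  haveI : IsLocalHom (algebraMap S ((Spec (.of S)).presheaf.stalk z₀)) := ⟨fun a ha => by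
    have h := (IsLocalization.AtPrime.isUnit_to_map_iff ((Spec (.of S)).presheaf.stalk z₀) (maximalIdeal S) a).mp ha
    exact (IsLocalRing.notMem_maximalIdeal).mp h⟩
  have hmaxA : maximalIdeal ((Spec (.of S)).presheaf.stalk z₀) =
      (maximalIdeal S).map (algebraMap S ((Spec (.of S)).presheaf.stalk z₀)) :=
    (IsLocalization.AtPrime.map_eq_maximalIdeal (maximalIdeal S) _).symm
  have hdimS : ringKrullDim S = (4 : ℕ) := by rw [← IsRegularLocalRing.spanFinrank_maximalIdeal, hd]
  have hdimA : ringKrullDim ((Spec (.of S)).presheaf.stalk z₀) = (4 : ℕ) := by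
    rw [IsLocalization.AtPrime.ringKrullDim_eq_height (maximalIdeal S) ((Spec (.of S)).presheaf.stalk z₀),
      IsLocalRing.maximalIdeal_height_eq_ringKrullDim, hdimS]
  have hdA : (maximalIdeal ((Spec (.of S)).presheaf.stalk z₀)).spanFinrank = 4 := by
    have h := IsRegularLocalRing.spanFinrank_maximalIdeal (R := (Spec (.of S)).presheaf.stalk z₀)
    rw [hdimA] at h
    exact_mod_cast h
  -- the regular system `(x₃, x₀, x₁, x₂)` read in the stalk
  let c : Fin 4 → (Spec (.of S)).presheaf.stalk z₀ := fun i =>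
    algebraMap S _ (x (![3, 0, 1, 2] i))
  have hc0 : c 0 = algebraMap S _ (x 3) := rfl
  have hcs : (fun k : Fin 3 => c k.succ) = fun k : Fin 3 => algebraMap S _ (x k.castSucc) := by
    funext k
    fin_cases k <;> rfl
  have hrange : Set.range c = algebraMap S ((Spec (.of S)).presheaf.stalk z₀) '' Set.range x := by
    ext t
    constructor
    · rintro ⟨i, rfl⟩
      exact ⟨x (![3, 0, 1, 2] i), ⟨_, rfl⟩, rfl⟩
    · rintro ⟨_, ⟨i, rfl⟩, rfl⟩
      fin_cases i
      · exact ⟨1, rfl⟩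
      · exact ⟨2, rfl⟩
      · exact ⟨3, rfl⟩
      · exact ⟨0, rfl⟩
  have hc : Ideal.span (Set.range c) = maximalIdeal ((Spec (.of S)).presheaf.stalk z₀) := by
    rw [hrange, ← Ideal.map_span, hx, hmaxA]
  have hJ : stalkIdeal J₀ z₀ = maximalIdeal ((Spec (.of S)).presheaf.stalk z₀) := by
    rw [hJ₀, DepthTargets.stalkIdeal_idealSheaf_eq, hmaxA]
    rfl
  -- the form over the stalk and its certificates
  set N' : MvPolynomial (Fin 3) ((Spec (.of S)).presheaf.stalk z₀) :=
    MvPolynomial.map (algebraMap S ((Spec (.of S)).presheaf.stalk z₀)) N with hN'def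
  have hN' : N'.IsHomogeneous deg := hN.map _
  have hV' := coneHV_map (algebraMap S ((Spec (.of S)).presheaf.stalk z₀)) N hV
  have hC' : ∀ i : Fin 4, i ≠ 0 → Ideal.span (insert (chartPoly (MvPolynomial.rename Fin.succ N') i)
      (Set.range fun t => MvPolynomial.pderiv t (chartPoly (MvPolynomial.rename Fin.succ N') i))) = ⊤ :=
    fun i hi => coneHC_map (algebraMap S ((Spec (.of S)).presheaf.stalk z₀)) N i (hC i hi)
  have heval : algebraMap S ((Spec (.of S)).presheaf.stalk z₀) q = MvPolynomial.eval (fun k : Fin 3 => c k.succ) N' := by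
    rw [hcs, hqdef]
    exact map_eval_eq_eval_map (algebraMap S ((Spec (.of S)).presheaf.stalk z₀)) (fun k : Fin 3 => x k.castSucc) N
  have hH₀ : stalkIdeal Hq z₀ = Ideal.span {MvPolynomial.eval (fun k : Fin 3 => c k.succ) N'} := by
    rw [hHq, DepthTargets.stalkIdeal_idealSheaf_eq, Ideal.map_span, Set.image_singleton]
    exact congrArg (fun t => Ideal.span {t}) heval
  have hG₀' : stalkIdeal G₀ z₀ = Ideal.span {c 0} := by
    rw [hG₀, DepthTargets.stalkIdeal_idealSheaf_eq, Ideal.map_span, Set.image_singleton, hc0]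
    rfl
  -- THE SMOOTH-CONE VERTEX FIBRE THEOREM on `Spec S`
  obtain ⟨z₁, hσz₁, ⟨c', hreg', hc', hd', hE', hhost', -⟩, hsnc⟩ :=
    smoothCone_vertex_fibre hσ z₀ c hc hdA hJ deg N' hN' hV' hC' Hq G₀ hH₀ hG₀'
  have h𝔪 : maximalIdeal S ≠ ⊥ := by
    intro h
    rw [h, Submodule.spanFinrank_bot] at hd
    exact absurd hd (by norm_num)
  haveI : IsProper σ := hσ.isProper
  haveI : IsLocallyNoetherian (blowup J₀) := LocallyOfFiniteType.isLocallyNoetherian σ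
  have hsuppJ₀ : ∀ s : Spec (.of S), s ∈ J₀.support → s = IsLocalRing.closedPoint S := fun s hs =>
    support_idealSheaf_subset_closedPoint (Q := maximalIdeal S) (n := 1) (by rw [pow_one]) s hs
  -- `q ∈ 𝔪^d` and the transform identity for the cone
  have hqmem : q ∈ maximalIdeal S ^ deg := by
    rw [hqdef, show MvPolynomial.eval (fun k : Fin 3 => x k.castSucc) N =
      MvPolynomial.eval x (MvPolynomial.rename Fin.castSucc N) from (MvPolynomial.eval_rename Fin.castSucc x N).symm]
    exact Literature.RingTheory.HilbertSamuel.eval_mem_pow_of_isHomogeneous x hx hN.rename_isHomogeneous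
  have hH : J₀.comap σ ^ deg * controlledTransform σ J₀ Hq deg = Hq.comap σ := by
    refine pow_mul_controlledTransform_eq σ J₀ hσ.isEffectiveCartier ?_
    rw [← comap_pow]
    refine Scheme.IdealSheafData.comap_mono σ ?_
    rw [hJ₀, ← DepthOne.idealSheaf_pow]
    refine idealSheaf_mono ?_
    rw [Ideal.span_singleton_le_iff_mem]
    exact hqmem
  refine ⟨z₁,
    { two_le := hdeg
      isIntegral := hσ.isIntegral (affineBlowup.idealSheaf_ne_bot h𝔪)
      isNoetherian := ?_
      isRegular := ?_
      exists_isBlowup := ⟨J₀, hσ, fun s hs => Set.mem_singleton_iff.mpr (hsuppJ₀ s hs)⟩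
      isLocallyPrincipal := hσ.isEffectiveCartier.isLocallyPrincipal.pow deg
      boundaryOf_eq := rfl
      format := ?_
      isClosed := ?_
      apply_eq := hσz₁
      vertex := ⟨c', hreg', hc', hd', hhost', hE'⟩
      not_mem_support := fun D hD => by simp [boundaryOf] at hD
      snc := ?_ }⟩
  · haveI : CompactSpace (blowup J₀) := QuasiCompact.compactSpace_of_compactSpace σ
    exact {}
  · refine IsBlowup.isRegular_of_isRegular_subscheme (Scheme.isRegular_Spec (.of S)) ?_ hσ
    refine Scheme.isRegular_subscheme_of_forall J₀ fun y hy => ?_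
    obtain rfl : y = z₀ := hsuppJ₀ y hy
    rw [hJ]
    letI := Ideal.Quotient.field (maximalIdeal ((Spec (.of S)).presheaf.stalk z₀))
    infer_instance
  · -- THE FORMAT `I𝒪_{X₁} = 𝓘_{E₁}^d · (𝓗₁ ⊔ 𝓘_{E₁}^ℓ)`
    rw [DepthTargets.idealSheaf_sup_eq, DepthOne.idealSheaf_pow, Scheme.IdealSheafData.comap_sup, comap_pow, ← hH,
      List.nil_append, List.nil_append, monomialIdeal_singleton, monomialIdeal_singleton, pow_zero,
      Scheme.IdealSheafData.one_eq_top, Scheme.IdealSheafData.mul_top, ← Scheme.IdealSheafData.add_eq_sup,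
      ← Scheme.IdealSheafData.add_eq_sup]
    ring
  · refine hσ.isClosed_singleton_of_ringKrullDim_eq (x' := z₁) (by rw [hσz₁]; exact hz₀) ?_
    rw [hσz₁, ← IsRegularLocalRing.spanFinrank_maximalIdeal, hd', hdimA]
  · intro x₁ hx₁ hne
    refine (hsnc x₁ hx₁ hne).anti fun D hD _ => ?_
    simp only [boundaryOf, List.map_nil, List.nil_append, List.mem_cons, List.not_mem_nil, or_false] at hD
    rcases hD with rfl | rfl
    · exact List.mem_cons_self
    · exact List.mem_cons_of_mem _ List.mem_cons_self

end SmoothConeState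

end Climb

end ConeDepth

end Summit.ResolutionOfSingularities.ResolutionOfSingularities.Theorems

end
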